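import Mathlib
import HarnessLib.Audit
import Summits.PneNP.PneNP.Theorems.PstarNorDataProof
import Summits.PneNP.PneNP.Theorems.PstarNorCore
import Summits.PneNP.PneNP.Theorems.PstarLitNorCore

/-!
# GAPTWO-PLAN S4c by name: `LitNorCoreBound` (and `NorCoreBound`) (ROUND-24, cell `pnp-ideate`)

FRONTIER range-avoidance ladder, rung F-N3, ROUND 24 (restricted-model proof complexity — nothing here bears on `P` versus `NP`).

Both typed forms of the NOR-core accounting lemma (planner memo `CORE-BOUND-NOTES.md` §5) are instances of the generic
`PstarNorDataProof.card_le_five`: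

* `litNorCoreBound : PstarLitNorCore.LitNorCoreBound` — S4c as corrected by the planner (centre = LITERAL edges, the outputs of `J₀`
  holding `σ` or `τ` in an AND slot; `C := J₀.filter (LitEdge I σ τ)`); the `IsChord` clause of `LitNorStructure` is not even needed;
* `norCoreBound : PstarNorCore.NorCoreBound` — the first typing (centre = non-chords; `C := J₀.filter (¬ IsChord I J₀ ·)`).
-/

set_option linter.dupNamespace false

open Finset Literature.Computability.Complexity
open Summit.PneNP.PneNP.Theorems.PstarSALevel (BoundaryExpanding SimpleOverlap)
open Summit.PneNP.PneNP.Theorems.PstarChordRepair (IsChord)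
open Summit.PneNP.PneNP.Theorems.PstarCoreBound (XorClosed)
open Summit.PneNP.PneNP.Theorems.PstarNorCore (CentreAdj NorStructure NorCoreBound)
open Summit.PneNP.PneNP.Theorems.PstarLitNorCore (LitEdge LitAdj LitNorStructure LitNorCoreBound)
open Summit.PneNP.PneNP.Theorems.PstarNorDataTools (CAdj CoreData)
open Summit.PneNP.PneNP.Theorems.PstarNorDataProof (card_le_five)

namespace Summit.PneNP.PneNP.Theorems.PstarLitNorCoreProof

variable {n m : ℕ}

/-- A literal NOR structure gives generic NOR data with centre set the literal edges of `J₀`. -/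
theorem coreData_of_litNorStructure (I : LocalMap 4 n m) {J₀ : Finset (Fin m)} {σ τ : Fin n} {g₀ : Fin m}
    [DecidablePred (LitEdge I σ τ)] (h : LitNorStructure I J₀ σ τ g₀) :
    CoreData I J₀ (J₀.filter (LitEdge I σ τ)) σ τ g₀ := by
  obtain ⟨hne, hg₀, hpair, hch⟩ := h
  refine ⟨filter_subset _ _, hne, hg₀, hpair, fun f hf => (mem_filter.1 hf).2, fun e he heC => ?_⟩
  have hlit : ¬ LitEdge I σ τ e := fun hl => heC (mem_filter.2 ⟨he, hl⟩)
  have hle : ∀ v v', LitAdj I J₀ σ τ v v' → CAdj I (J₀.filter (LitEdge I σ τ)) v v' :=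
    fun v v' ⟨f, hf, hl, hvv'⟩ => ⟨f, mem_filter.2 ⟨hf, hl⟩, hvv'⟩
  exact Relation.ReflTransGen.mono hle _ _ (hch e he hlit).2

/-- **GAPTWO-PLAN S4c (corrected) — the NOR-core accounting lemma, literal-edge form.** -/
theorem litNorCoreBound : LitNorCoreBound := by
  classical
  intro n m r I hI hB hS J₀ σ τ g₀ hk hx hN
  exact card_le_five hI hB hS hk hx (coreData_of_litNorStructure I hN)

/-- A NOR structure in the first typing gives generic NOR data with centre set the non-chords of `J₀`. -/
theorem coreData_of_norStructure (I : LocalMap 4 n m) {J₀ : Finset (Fin m)} {σ τ : Fin n} {g₀ : Fin m}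
    [DecidablePred (IsChord I J₀)] (h : NorStructure I J₀ σ τ g₀) :
    CoreData I J₀ (J₀.filter fun f => ¬ IsChord I J₀ f) σ τ g₀ := by
  obtain ⟨hne, hg₀, hpair, hcen, hch⟩ := h
  refine ⟨filter_subset _ _, hne, hg₀, hpair, fun f hf => hcen f (mem_filter.1 hf).1 (mem_filter.1 hf).2, fun e he heC => ?_⟩
  have hc : IsChord I J₀ e := by
    by_contra hc
    exact heC (mem_filter.2 ⟨he, hc⟩)
  have hle : ∀ v v', CentreAdj I J₀ v v' → CAdj I (J₀.filter fun f => ¬ IsChord I J₀ f) v v' :=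
    fun v v' ⟨f, hf, hnc, hvv'⟩ => ⟨f, mem_filter.2 ⟨hf, hnc⟩, hvv'⟩
  exact Relation.ReflTransGen.mono hle _ _ (hch e he hc)

/-- **GAPTWO-PLAN S4c, first typing — `NorCoreBound`.** -/
theorem norCoreBound : NorCoreBound := by
  classical
  intro n m r I hI hB hS J₀ σ τ g₀ hk hx hN
  exact card_le_five hI hB hS hk hx (coreData_of_norStructure I hN)

end Summit.PneNP.PneNP.Theorems.PstarLitNorCoreProof
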